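import Mathlib.Geometry.Manifold.Instances.Sphere
import Mathlib.Geometry.Manifold.Diffeomorph
import Mathlib.AlgebraicTopology.FundamentalGroupoid.SimplyConnected
import Literature.Geometry.Riemannian.IsotropicCurvature
import HarnessLib

/-!
# Positive curvature operator: the hypothesis of Hamilton's theorem on 4-manifolds
(topic `Geometry/Riemannian`)

A node of the decomposition of `Literature.Geometry.Riemannian.hamilton_chen_tang_zhu` (`HamiltonPIC.lean`;
Hamilton 1997, Cor. 1.2(a)) along Hamilton's programme: in the Ricci flow with surgery on a
compact 4-manifold with positive isotropic curvature, the compact components on which the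
curvature operator has become positive are discarded, their topology being known by
**Hamilton 1986, Thm. 1.1** ("A compact four-manifold with a positive curvature operator is
diffeomorphic to the sphere `S⁴` or the real projective space `RP⁴`"; quoted as "[4]" in
Hamilton 1997, p. 3, and as "[Ha2]" in Chen–Zhu 2006, p. 2: "When the solution has positive
curvature operator everywhere, it is diffeomorphic to `S⁴` or `RP⁴` by [Ha2], so the topology
of the manifold is understood and one can throw it away"). This file makes the notion real; the
theorem itself is vended in its printed generality (`S⁴` or `RP⁴`) as the named fact
`hamilton_positiveCurvatureOperator_classification_four` of `HamiltonPCOClassification.lean`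
(which imports this file), where its simply connected case — such a manifold with `π₁ = 1` is
diffeomorphic to `S⁴`, since `π₁(RP⁴) = ℤ₂` — is PROVED from it
(`hamilton_positiveCurvatureOperator_sphere_four_of_classification`).

## Contents

* `PseudoRiemannianMetric.curvatureOperatorForm g cov x X Y` — the value `Rm(φ, φ)` of the
  curvature operator, regarded as a symmetric bilinear form on 2-vectors, on the 2-vector
  `φ = Σₐ Xₐ ∧ Yₐ` (`X Y : Fin m → T_x M`): `Σ_{a,b} Rm(Xₐ, Yₐ, Y_b, X_b)` with the tree's
  `curvatureForm` (`Rm(X,Y,Z,W) = g(R(X,Y)Z, W)`), normalised so that a decomposable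
  `φ = X ∧ Y` gives the numerator `Rm(X,Y,Y,X)` of the sectional curvature `K(X, Y)`. Every
  2-vector is such a finite sum, so no exterior-power machinery is needed.
* `PseudoRiemannianMetric.bivectorForm g x X Y v w = Σₐ (g(Xₐ,v) g(Yₐ,w) - g(Yₐ,v) g(Xₐ,w))` —
  the alternating form `φ♭` of `φ = Σₐ Xₐ ∧ Yₐ`; for nondegenerate `g`, `φ ≠ 0 ↔ φ♭ ≠ 0`,
  which is how "`φ ≠ 0`" is expressed.
* `HasPositiveCurvatureOperatorWith g cov` / `HasPositiveCurvatureOperator g` — Hamilton 1986,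
  p. 153: "We say the manifold has a positive curvature operator if `Rm(φ, φ) > 0` for all
  two-forms `φ ≠ 0`"; the second form quantifies over Levi-Civita connections of `g` exactly as
  `HasPositiveIsotropicCurvature` does. Both are the printed *definition* — predicates on
  `(g, cov)` resp. `g`, with explicit binders — not assertions: there is no
  `HasPositiveCurvatureOperatorWith_holds` (a flat connection has `Rm(φ, φ) = 0` for all `φ`,
  `not_hasPositiveCurvatureOperatorWith_of_isFlat`; flat tori exist, Hamilton 1986, p. 154).
  What the paper *proves* about the notion is Thm. 1.1 (the named fact
  `hamilton_positiveCurvatureOperator_classification_four`, `HamiltonPCOClassification.lean`).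
* API (proved): positivity of all sectional curvatures `Rm(X,Y,Y,X) > 0` on nondegenerate
  planes (`HasPositiveCurvatureOperatorWith.curvatureForm_pos`), unfolding lemmas, and
  `not_hasPositiveCurvatureOperatorWith_of_isFlat` (flat connection + one nonzero 2-vector ⇒ not
  positive curvature operator).
* No named fact lives in this file any more. Until 2026-08-15 it ended with the named fact
  `hamilton_positiveCurvatureOperator_sphere_four` (Thm. 1.1 in the simply connected case:
  closed simply connected PCO 4-manifold `⇒` diffeomorphic to `S⁴`). That statement is the
  three-line corollary of the printed theorem `hamilton_positiveCurvatureOperator_classification_four`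
  (`HamiltonPCOClassification.lean`), where it had already been derived, so the separate `def` was a
  duplicate entry of the same debt (one theorem of the source, one named fact; D-0026 review) and
  was merged into that file as the theorem
  `hamilton_positiveCurvatureOperator_sphere_four_of_classification`, with the same hypotheses and
  conclusion. The imports `Instances.Sphere`, `Diffeomorph`, `SimplyConnected` are kept for the
  modules downstream that receive them through this file.

## References

* R. S. Hamilton, *Four-manifolds with positive curvature operator*, J. Differential Geom. 24
  (1986) 153–179, §1, Thm. 1.1 and the definition following it (p. 153). [Hamilton1986]
* R. S. Hamilton, *Four-manifolds with positive isotropic curvature*, Comm. Anal. Geom. 5 (1997)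
  1–92, pp. 3–4 (use of [4] = Hamilton 1986 in the surgery programme). [Hamilton1997]
* B.-L. Chen, X.-P. Zhu, *Ricci flow with surgery on four-manifolds with positive isotropic
  curvature*, J. Differential Geom. 74 (2006) (arXiv:math/0504478), p. 2. [ChenZhu2006]
* J. M. Lee, *Introduction to Riemannian Manifolds*, 2nd ed. (2018), Ch. 8 (curvature operator
  on 2-vectors, sectional curvature (8.8)–(8.9)).
-/

noncomputable section

open Bundle Finset
open scoped Manifold ContDiff Topology BigOperators

namespace Literature.Geometry.Riemannian

section PseudoRiemannianMetric
open Literature.Geometry.Lorentzian (PseudoRiemannianMetric)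
open Literature.Geometry.Lorentzian.PseudoRiemannianMetric

variable {E : Type*} [NormedAddCommGroup E] [NormedSpace ℝ E] {H : Type*} [TopologicalSpace H]
  {I : ModelWithCorners ℝ E H} {M : Type*} [TopologicalSpace M] [ChartedSpace H M]
  [IsManifold I ∞ M] {n : ℕ∞ω}

variable (g : PseudoRiemannianMetric I n E (TangentSpace I : M → Type _))
  (cov : CovariantDerivative I E (TangentSpace I : M → Type _))

/-! ### The curvature operator as a quadratic form on 2-vectors -/

/-- The value `Rm(φ, φ)` of the **curvature operator**, regarded as a symmetric bilinear form on
2-vectors (Hamilton 1986, p. 153; Lee, *Riemannian Manifolds*, Ch. 8), on the 2-vector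
`φ = Σₐ Xₐ ∧ Yₐ` given by finitely many pairs `X Y : Fin m → T_x M`:
`Rm(φ, φ) = Σ_{a,b} Rm(Xₐ, Yₐ, Y_b, X_b)` (`curvatureForm`, `Rm(X,Y,Z,W) = g(R(X,Y)Z,W)`). For
`m = 1` this is `Rm(X, Y, Y, X)`, the numerator of the sectional curvature `K(X,Y)`
(`sectionalCurvature`), which fixes the sign convention: the round sphere has positive
curvature operator. [cite: Hamilton1986, §1, p. 153 (definition after Thm. 1.1)] -/
def _root_.Literature.Geometry.Lorentzian.PseudoRiemannianMetric.curvatureOperatorForm (x : M) {m : ℕ} (X Y : Fin m → TangentSpace I x) : ℝ :=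
  ∑ a, ∑ b, g.curvatureForm cov x (X a) (Y a) (Y b) (X b)

/-- The **alternating form of a 2-vector**: for `φ = Σₐ Xₐ ∧ Yₐ`,
`φ♭(v, w) = Σₐ (g(Xₐ, v) g(Yₐ, w) - g(Yₐ, v) g(Xₐ, w))`, i.e. `φ` with both indices lowered by
`g`, evaluated on `(v, w)`. Since `g_x` is nondegenerate, `φ ↦ φ♭` is injective on `Λ² T_x M`, so
"`φ ≠ 0`" is equivalently "`φ♭(v, w) ≠ 0` for some `v, w`"; this is how non-vanishing of the
2-vector is expressed below without exterior powers. [folklore] -/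
def _root_.Literature.Geometry.Lorentzian.PseudoRiemannianMetric.bivectorForm (x : M) {m : ℕ} (X Y : Fin m → TangentSpace I x) (v w : TangentSpace I x) : ℝ :=
  ∑ a, (g.val x (X a) v * g.val x (Y a) w - g.val x (Y a) v * g.val x (X a) w)

/-- `φ♭` is alternating: `φ♭(v, w) = -φ♭(w, v)`. [folklore] -/
theorem _root_.Literature.Geometry.Lorentzian.PseudoRiemannianMetric.bivectorForm_swap (x : M) {m : ℕ} (X Y : Fin m → TangentSpace I x)
    (v w : TangentSpace I x) : g.bivectorForm x X Y v w = - g.bivectorForm x X Y w v := by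
  simp only [bivectorForm, ← Finset.sum_neg_distrib]
  refine Finset.sum_congr rfl fun a _ ↦ ?_
  ring

/-- `φ♭(v, v) = 0`. [folklore] -/
@[simp] theorem _root_.Literature.Geometry.Lorentzian.PseudoRiemannianMetric.bivectorForm_self (x : M) {m : ℕ} (X Y : Fin m → TangentSpace I x)
    (v : TangentSpace I x) : g.bivectorForm x X Y v v = 0 := by
  simp only [bivectorForm]
  exact Finset.sum_eq_zero fun a _ ↦ by ring

/-- For a single pair (`m = 1`), `Rm(X ∧ Y, X ∧ Y) = Rm(X, Y, Y, X)`. [folklore] -/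
@[simp] theorem _root_.Literature.Geometry.Lorentzian.PseudoRiemannianMetric.curvatureOperatorForm_one (x : M) (X Y : Fin 1 → TangentSpace I x) :
    g.curvatureOperatorForm cov x X Y = g.curvatureForm cov x (X 0) (Y 0) (Y 0) (X 0) := by
  simp [curvatureOperatorForm]

/-- For a single pair, `(X ∧ Y)♭(v, w) = g(X,v) g(Y,w) - g(Y,v) g(X,w)`. [folklore] -/
@[simp] theorem _root_.Literature.Geometry.Lorentzian.PseudoRiemannianMetric.bivectorForm_one (x : M) (X Y : Fin 1 → TangentSpace I x)
    (v w : TangentSpace I x) :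
    g.bivectorForm x X Y v w = g.val x (X 0) v * g.val x (Y 0) w - g.val x (Y 0) v * g.val x (X 0) w := by
  simp [bivectorForm]

/-! ### Positive curvature operator -/

/-- **Positive curvature operator for the pair `(g, cov)`** (Hamilton 1986, p. 153: "We say the
manifold has a positive curvature operator if `Rm(φ, φ) > 0` for all two-forms `φ ≠ 0`"): at
every point `x`, for every 2-vector `φ = Σₐ Xₐ ∧ Yₐ` which is nonzero (`φ♭ ≠ 0`,
`bivectorForm`), `Rm(φ, φ) = Σ_{a,b} Rm(Xₐ, Yₐ, Y_b, X_b) > 0` (`curvatureOperatorForm`).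
Intended for `cov` a Levi-Civita connection of a Riemannian `g`. This is the printed
*definition*, a predicate on the pair `(g, cov)` — hence the explicit binders — and not an
assertion: there is no `HasPositiveCurvatureOperatorWith_holds`, since a flat connection has
`Rm(φ, φ) = 0` for every `φ` (`not_hasPositiveCurvatureOperatorWith_of_isFlat` below; compact flat
examples are the tori, Hamilton 1986, p. 154: "The quotients of `R⁴` give the torus `T⁴` and all
the other flat four-manifolds"). What Hamilton 1986 proves about the notion is Thm. 1.1, the
named fact `hamilton_positiveCurvatureOperator_classification_four` (`HamiltonPCOClassification.lean`).
[cite: Hamilton1986, §1, p. 153 (definition after Thm. 1.1)] -/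
def _root_.Literature.Geometry.Lorentzian.PseudoRiemannianMetric.HasPositiveCurvatureOperatorWith (g : PseudoRiemannianMetric I n E (TangentSpace I : M → Type _))
    (cov : CovariantDerivative I E (TangentSpace I : M → Type _)) : Prop :=
  ∀ (x : M) (m : ℕ) (X Y : Fin m → TangentSpace I x),
    (∃ v w : TangentSpace I x, g.bivectorForm x X Y v w ≠ 0) → 0 < g.curvatureOperatorForm cov x X Y

/-- **Positive curvature operator** (Hamilton 1986, p. 153), for the metric `g` itself: for every
covariant derivative `cov` on `TM` which is a Levi-Civita connection of `g`
(`PseudoRiemannianMetric.IsLeviCivita`; it exists and is unique for `C¹` metrics,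
`LeviCivita.lean`), `(g, cov)` has positive curvature operator. Same sorry-free phrasing as
`HasPositiveIsotropicCurvature`, and, like it, a *definition* (predicate on `g`, which is an explicit
binder of the declaration), not an assertion: there is no `HasPositiveCurvatureOperator_holds`
(flat Levi-Civita connections; closed counterexamples `not_hasPositiveCurvatureOperator_of_isFlat`,
`not_hasPositiveCurvatureOperator_euclideanSpace_four` in `TwoPositiveCurvatureOperatorProofs.lean`).
[cite: Hamilton1986, §1, p. 153 (definition after Thm. 1.1)] -/
def _root_.Literature.Geometry.Lorentzian.PseudoRiemannianMetric.HasPositiveCurvatureOperator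
    (g : PseudoRiemannianMetric I n E (TangentSpace I : M → Type _)) [FiniteDimensional ℝ E]
    [CompleteSpace E] : Prop :=
  ∀ cov : CovariantDerivative I E (TangentSpace I : M → Type _), g.IsLeviCivita cov →
    g.HasPositiveCurvatureOperatorWith cov

variable {g cov}

/-- Specialising to a Levi-Civita connection. [folklore] -/
theorem _root_.Literature.Geometry.Lorentzian.PseudoRiemannianMetric.HasPositiveCurvatureOperator.with [FiniteDimensional ℝ E] [CompleteSpace E]
    (h : g.HasPositiveCurvatureOperator) (hcov : g.IsLeviCivita cov) :
    g.HasPositiveCurvatureOperatorWith cov :=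
  h cov hcov

/-- **Positive curvature operator implies positive sectional curvature**: if `(g, cov)` has
positive curvature operator then `Rm(X, Y, Y, X) > 0` for every pair `X, Y` spanning a
nondegenerate plane (`(X ∧ Y)♭ ≠ 0`, i.e. `g(X,v) g(Y,w) ≠ g(Y,v) g(X,w)` for some `v, w`);
the case `φ = X ∧ Y` of the definition (Hamilton 1986, §1; Lee, *Riemannian Manifolds*, Ch. 8).
[cite: Hamilton1986, §1, p. 153] -/
theorem _root_.Literature.Geometry.Lorentzian.PseudoRiemannianMetric.HasPositiveCurvatureOperatorWith.curvatureForm_pos (h : g.HasPositiveCurvatureOperatorWith cov)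
    (x : M) (X Y : TangentSpace I x)
    (hXY : ∃ v w : TangentSpace I x, g.val x X v * g.val x Y w - g.val x Y v * g.val x X w ≠ 0) :
    0 < g.curvatureForm cov x X Y Y X := by
  have := h x 1 (fun _ ↦ X) (fun _ ↦ Y) (by simpa using hXY)
  simpa using this

/-- In particular, for a `g`-orthonormal pair `X, Y` (`g(X,X) = g(Y,Y) = 1`, `g(X,Y) = 0`) the
sectional curvature `K(X, Y) = Rm(X,Y,Y,X)` is positive. [cite: Hamilton1986, §1, p. 153] -/
theorem _root_.Literature.Geometry.Lorentzian.PseudoRiemannianMetric.HasPositiveCurvatureOperatorWith.sectionalCurvature_pos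
    (h : g.HasPositiveCurvatureOperatorWith cov) (x : M) {X Y : TangentSpace I x}
    (hX : g.val x X X = 1) (hY : g.val x Y Y = 1) (hXY : g.val x X Y = 0) :
    0 < g.sectionalCurvature cov x X Y := by
  rw [sectionalCurvature_of_orthonormal g cov x hX hY hXY]
  refine h.curvatureForm_pos x X Y ⟨X, Y, ?_⟩
  rw [hX, hY, hXY, g.symm x Y X, hXY]
  norm_num

/-! ### Why there is no `HasPositiveCurvatureOperatorWith_holds`: flat connections -/

/-- For a flat connection (`cov.IsFlat`: the curvature tensor vanishes identically,
`Curvature.lean`) the curvature operator form vanishes on every 2-vector: `Rm(φ, φ) = 0`.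
[folklore] -/
theorem _root_.Literature.Geometry.Lorentzian.PseudoRiemannianMetric.curvatureOperatorForm_eq_zero_of_isFlat (h : cov.IsFlat)
    (x : M) {m : ℕ} (X Y : Fin m → TangentSpace I x) : g.curvatureOperatorForm cov x X Y = 0 := by
  simp [curvatureOperatorForm, curvatureForm, (cov.isFlat_iff).1 h]

/-- **A flat connection never has positive curvature operator** (given one nonzero 2-vector):
if `cov` is flat then `Rm(φ, φ) = 0` for every `φ`, so as soon as some point `x` carries a
2-vector `φ = Σₐ Xₐ ∧ Yₐ` with `φ♭ ≠ 0` (any point of a pseudo-Riemannian manifold of dimension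
`≥ 2`), the pair `(g, cov)` does not have positive curvature operator. Compact flat Riemannian
4-manifolds exist (the torus `T⁴`; Hamilton 1986, p. 154), so `HasPositiveCurvatureOperatorWith`
is a hypothesis — the one of Hamilton 1986, Thm. 1.1 — and not a theorem: the definition has no
`_holds` companion. [folklore] -/
theorem _root_.Literature.Geometry.Lorentzian.PseudoRiemannianMetric.not_hasPositiveCurvatureOperatorWith_of_isFlat (h : cov.IsFlat)
    {x : M} {m : ℕ} {X Y : Fin m → TangentSpace I x}
    (hXY : ∃ v w : TangentSpace I x, g.bivectorForm x X Y v w ≠ 0) :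
    ¬ g.HasPositiveCurvatureOperatorWith cov := fun hpos ↦
  (hpos x m X Y hXY).ne' (curvatureOperatorForm_eq_zero_of_isFlat h x X Y)

end PseudoRiemannianMetric

end Literature.Geometry.Riemannian

end
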